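import Mathlib
import Summits.QuantumFields.BalabanUV.Beta.AnalyticWalkSum216RowConstrainedDict
import Summits.QuantumFields.BalabanUV.Beta.CoarseCoerciveQuasiReconstruction

/-!
# [Balaban1985BackgroundPropagators] (3.132) p. 422 ∕ [Balaban1984PropagatorsII] (2.76)–(2.78) p. 236 — THE COERCIVITY DATUM
# OF THE CONSTRAINED LAYER, END TO END IN ABSTRACT FORM: a quasi-reconstruction for the averaging `Q̃` relative to the fine
# form `A = G₂⁻¹` ⟹ `Re`-coercivity of the coarse operator `Q̃·A⁻¹·Q̃ᵀ` (γ = c²∕E) ⟹ `Re`-coercivity of its square lift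
# `1 + Σ_ω Kp_ω = liftSq E (Q̃G₂Q̃ᵀ)` on the fine index type (γ′ = min(γ, 1)) — LITERALLY the hypothesis `hRe` of the
# co-owner's box END `UnitLatticeOmegaBoxLocal.termSum_box_of_pieceMaj` for the coarse pieces of interface item (I3)
# (cell topic `Summits/QuantumFields/BalabanUV/Beta`; row-D4 NODE A.4 leaf A.4.5, instance half (I3), abstract form)

HONEST FRAMING (cell rule).  Discharging `BetaPertH` makes Bałaban's UV stability UNCONDITIONAL — a real constructive-QFT
result; NOT the continuum limit, NOT the Clay problem.  This module discharges NOTHING of `BetaPertH`.  [folklore] linear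
algebra, kernel-checked: the JUNCTION between the owner lineage's gen-39 modules (`AnalyticWalkSum216RowConstrainedDict`:
the coarse pieces sum to `Eᵀ(Q̃𝒢Q̃ᵀ − 1)E`, `1 + Eᵀ(C − 1)E = liftSq E C`; `CoarseCoerciveQuasiReconstruction`: coercivity
`c²∕E` of `Q·A⁻¹·Q*` from a quasi-reconstruction) and the co-owner's gen-5 box END (unit `b2b-balaban-beta-d4-p3`,
`UnitLatticeOmegaBoxLocal.termSum_box_of_pieceMaj`, p219834: local inverses CONSTRUCTED by accretive Combes–Thomas given ONE
global `Re`-coercivity datum `hRe : ∀ z, γ‖z‖² ≤ Re z*(1 + Σ_ω K_ω)z` — «the coarse layer (I3): G-B9-15's lower bound; not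
moved»).  After this file that datum, for the coarse layer, READS: a bounded-energy quasi-reconstruction for Bałaban's `Q̃`
relative to `G₂⁻¹` (NOTE-I3's E-I3) — nothing else (`hRe_coarse_of_quasiReconstruction`).  Nothing of Bałaban's
operators is instantiated; E-I3 itself is NOT supplied here (U = 1: a MODEL node; general U: located, B7∕(3.35)); NO class
change on any GAPS row (G-B9-15 decomposed, not closed); readiness width 0 unchanged; NOT summit progress.  Unit
`b2b-balaban-beta-an4-g39` (owner lineage of `BINDER-OWNERS.md` row D4); `GAPS.md` C-an4-105.

CITATION HEADER (lean-in-tree rule).  [13] = T. Bałaban, *Propagators for lattice gauge theories in a background field*,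
Commun. Math. Phys. **99**, 389–434 (1985) [Balaban1985BackgroundPropagators], p. 422 (3.132) and the sentence before it
(quoted in `CoarseCoerciveQuasiReconstruction`'s header; render read today); [B6] = T. Bałaban, *Propagators and
renormalization transformations for lattice gauge theories. II*, Commun. Math. Phys. **96**, 223–250 (1984)
[Balaban1984PropagatorsII], (2.76)–(2.78) p. 236 (idem).  LOCATORS only; nothing printed is asserted.

WHAT IS CERTIFIED HERE (kernel, sorry-free; [folklore]).
§1 `embM_mulVec` (`(E z)_a = z_{e a}`), `nsq_embM_mulVec_le` (`‖Ez‖² ≤ ‖z‖²` for injective `e`), `form_liftSq`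
   (`z*(liftSq E C)z = (Ez)*C(Ez) + (‖z‖² − ‖Ez‖²)` for `E = embM e`), **`reCoercive_liftSq`** (`Re`-coercivity `γ` of `C`
   on the coarse index ⟹ `Re`-coercivity `min(γ,1)` of `liftSq E C` on the fine index), **`reCoercive_one_add_Ktot`** (the
   same for `1 + Σ_ω Kp_ω` under the instance statement `Σ_ω Kp_ω = Eᵀ(C − 1)E` — d4-p3's `hRe` SHAPE).
§2 `sandwich_eq_of_real` (for a REAL rectangular `Q̃`, d4-p3's `sandwich A (rows of Q̃) = Q̃·A⁻¹·Q̃ᵀ`),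
   **`reCoercive_coarse_of_quasiReconstruction`** (`γ = c²∕E` for `C = Q̃A⁻¹Q̃ᵀ`).
§3 **`hRe_coarse_of_quasiReconstruction`** — THE COMPOSITE: embedding + instance statement + `A` Hermitian invertible
   `Re`-psd + `Q̃` real + a quasi-reconstruction `(r, c, E)` ⟹ `∀ z, min(c²∕E, 1)·‖z‖² ≤ Re z*(1 + Σ_ω Kp_ω)z`.
§4 Non-vacuity on the two-site block of `AnalyticWalkSum216RowConstrainedWitness`'s data (`A = [[2,1],[1,2]]`, `Q̃ = (1 1)`,
   `r = q`: `c = 2`, `E = 6`, `γ = ⅔` — TIGHT: `Q̃A⁻¹Q̃ᵀ = ⅔` exactly).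
NOT CLAIMED.  E-I3 for any lattice; anything about Bałaban's operators; k-uniformity.  NOT summit progress.
PRIOR ART IN THE TREE (searched 2026-08-20): the two gen-39 siblings; d4-p3 `UnitLatticeOmegaBoxLocal` (consumer of `hRe`),
`UnitLatticeLocalInverse.reCoercive_compress` (coercivity under compression to a subset — the opposite direction of §1's
lift), `UnitLatticeProjectionWalk.reCoercive_rescale`.
-/

namespace Summit.QuantumFields.BalabanUV.Beta.AnalyticWalkSum216RowConstrainedCoercive

open scoped BigOperators Matrix ComplexConjugate
open Finset Matrix
open Summit.QuantumFields.BalabanUV.Beta.AnalyticWalkSum216RowConstrainedDict (embM embM_apply liftSq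
  one_add_conj_sub_one)
open Summit.QuantumFields.BalabanUV.Beta.CoarseCoerciveQuasiReconstruction (sandwich_coercive_of_quasiReconstruction)
open Summit.QuantumFields.BalabanUV.Beta.AccretiveCombesThomasSandwich (sandwich)
open Summit.QuantumFields.BalabanUV.Beta.UnitLatticeResolventWalk (Qm superpose sandwich_eq_mul)
open Summit.QuantumFields.BalabanUV.Beta.UnitLatticeOmegaTerms (Ktot)
open Literature.MathematicalPhysics.QuantumFieldTheory.Balaban1983to89.B5Prop11Lower (nsq nsq_nonneg
  star_dotProduct_self)

noncomputable section

variable {μ Y X : Type*} [Fintype μ] [Fintype Y] [Fintype X] [DecidableEq μ] [DecidableEq Y] [DecidableEq X]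

/-! ## §1 `Re`-coercivity survives the square lift -/

omit [Fintype μ] [DecidableEq μ] in
/-- `(E z)_a = z_{e a}` for the coordinate matrix. [folklore] -/
theorem embM_mulVec (e : μ → Y) (z : Y → ℂ) (a : μ) : (embM e *ᵥ z) a = z (e a) := by
  rw [Matrix.mulVec, dotProduct]
  simp only [embM_apply, ite_mul, one_mul, zero_mul]
  rw [Finset.sum_ite_eq, if_pos (Finset.mem_univ _)]

omit [DecidableEq μ] in
/-- `‖Ez‖² ≤ ‖z‖²` for an injective `e` (a sub-sum of squares). [folklore] -/
theorem nsq_embM_mulVec_le (e : μ → Y) (he : Function.Injective e) (z : Y → ℂ) : nsq (embM e *ᵥ z) ≤ nsq z := by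
  simp only [nsq, embM_mulVec]
  calc ∑ a, ‖z (e a)‖ ^ 2 = ∑ y ∈ Finset.univ.image e, ‖z y‖ ^ 2 := by
        rw [Finset.sum_image fun a _ b _ h => he h]
    _ ≤ ∑ y, ‖z y‖ ^ 2 := Finset.sum_le_sum_of_subset_of_nonneg (Finset.subset_univ _) fun _ _ _ => by positivity

omit [Fintype μ] [DecidableEq μ] in
/-- `E·(star z) = star (E z)` (the coordinate matrix is real). [folklore] -/
theorem embM_mulVec_star (e : μ → Y) (z : Y → ℂ) : embM e *ᵥ star z = star (embM e *ᵥ z) := by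
  ext a
  rw [embM_mulVec, Pi.star_apply, Pi.star_apply, embM_mulVec]

omit [DecidableEq μ] in
/-- **The form of the square lift**: `z*(liftSq E C)z = (Ez)*C(Ez) + (z*z − (Ez)*(Ez))` for `E = embM e`. [folklore] -/
theorem form_liftSq (e : μ → Y) (C : Matrix μ μ ℂ) (z : Y → ℂ) :
    star z ⬝ᵥ (liftSq (embM e) C *ᵥ z) =
      star (embM e *ᵥ z) ⬝ᵥ (C *ᵥ (embM e *ᵥ z)) + (star z ⬝ᵥ z - star (embM e *ᵥ z) ⬝ᵥ (embM e *ᵥ z)) := by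
  rw [liftSq, Matrix.add_mulVec, Matrix.sub_mulVec, Matrix.one_mulVec, dotProduct_add, dotProduct_sub,
    ← Matrix.mulVec_mulVec, ← Matrix.mulVec_mulVec, Matrix.dotProduct_mulVec, Matrix.vecMul_transpose,
    embM_mulVec_star, ← Matrix.mulVec_mulVec, Matrix.dotProduct_mulVec (star z) (embM e)ᵀ, Matrix.vecMul_transpose,
    embM_mulVec_star]

omit [DecidableEq μ] in
/-- **`Re`-COERCIVITY SURVIVES THE SQUARE LIFT**: if `Re w*Cw ≥ γ‖w‖²` on the coarse index then
`Re z*(liftSq E C)z ≥ min(γ, 1)·‖z‖²` on the fine index (`E = embM e`, `e` injective): the lift is `C` on the image and the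
identity on its complement. [folklore] -/
theorem reCoercive_liftSq (e : μ → Y) (he : Function.Injective e) (C : Matrix μ μ ℂ) {γ : ℝ}
    (hC : ∀ w : μ → ℂ, γ * nsq w ≤ (star w ⬝ᵥ (C *ᵥ w)).re) (z : Y → ℂ) :
    min γ 1 * nsq z ≤ (star z ⬝ᵥ (liftSq (embM e) C *ᵥ z)).re := by
  rw [form_liftSq, Complex.add_re, Complex.sub_re, star_dotProduct_self, star_dotProduct_self, Complex.ofReal_re,
    Complex.ofReal_re]
  have h1 := hC (embM e *ᵥ z)
  have h2 := nsq_embM_mulVec_le e he z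
  have h3 := nsq_nonneg (embM e *ᵥ z)
  have h4 := nsq_nonneg z
  rcases le_total γ 1 with hγ | hγ
  · rw [min_eq_left hγ]
    nlinarith
  · rw [min_eq_right hγ]
    nlinarith

/-- **d4-p3's `hRe` SHAPE for the coarse layer**: under the instance statement `Σ_ω Kp_ω = Eᵀ(C − 1)E`
(`AnalyticWalkSum216RowConstrainedDict.termSum_constrainedΩ_flucCov_embed`'s `hKtot` with `C = Q̃𝒢Q̃ᵀ`), `Re`-coercivity
`γ` of `C` gives `∀ z, min(γ,1)·‖z‖² ≤ Re z*(1 + Σ_ω Kp_ω)z`. [folklore] -/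
theorem reCoercive_one_add_Ktot {Ω' : Type*} [Fintype Ω'] (e : μ → Y) (he : Function.Injective e) (C : Matrix μ μ ℂ)
    {γ : ℝ} (hC : ∀ w : μ → ℂ, γ * nsq w ≤ (star w ⬝ᵥ (C *ᵥ w)).re) (Kp : Ω' → Matrix Y Y ℂ)
    (hKtot : Ktot Kp = (embM e)ᵀ * (C - 1) * embM e) (z : Y → ℂ) :
    min γ 1 * nsq z ≤ (star z ⬝ᵥ ((1 + Ktot Kp) *ᵥ z)).re := by
  rw [hKtot, one_add_conj_sub_one]
  exact reCoercive_liftSq e he C hC z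

/-! ## §2 The coarse operator of a real averaging as d4-p3's `sandwich`, and its coercivity -/

omit [Fintype μ] [DecidableEq μ] in
/-- For a REAL rectangular `Q̃` (all entries self-conjugate) the co-owner's sandwich of the ROWS of `Q̃` is
`Q̃·A⁻¹·Q̃ᵀ`. [folklore] -/
theorem sandwich_eq_of_real (A : Matrix X X ℂ) (Qt : Matrix μ X ℂ) (hreal : ∀ a x, (starRingEnd ℂ) (Qt a x) = Qt a x) :
    sandwich A (fun a x => Qt a x) = Qt * A⁻¹ * Qtᵀ := by
  have hQm : Qm (fun a x => Qt a x) = Qt := by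
    ext a x
    rw [Qm, hreal]
  have hQmH : (Qm (fun a x => Qt a x))ᴴ = Qtᵀ := by
    ext x a
    rw [Matrix.conjTranspose_apply, Qm, Complex.star_def, Complex.conj_conj, Matrix.transpose_apply]
  rw [sandwich_eq_mul, hQmH, hQm]

omit [DecidableEq μ] in
/-- **`Re`-coercivity of the coarse operator `Q̃A⁻¹Q̃ᵀ` from a quasi-reconstruction** (`γ = c²∕E`):
`CoarseCoerciveQuasiReconstruction.sandwich_coercive_of_quasiReconstruction` read through `sandwich_eq_of_real`.
[cite: Balaban1984PropagatorsII, (2.76)–(2.78) p.236] -/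
theorem reCoercive_coarse_of_quasiReconstruction (A : Matrix X X ℂ) (hH : A.IsHermitian) (hU : IsUnit A)
    (hpsd : ∀ g : X → ℂ, 0 ≤ (star g ⬝ᵥ (A *ᵥ g)).re) (Qt : Matrix μ X ℂ)
    (hreal : ∀ a x, (starRingEnd ℂ) (Qt a x) = Qt a x) (r : μ → X → ℂ) {c E : ℝ} (hc : 0 < c) (hE : 0 < E)
    (hmass : ∀ B : μ → ℂ, c * nsq B ≤ (star (superpose r B) ⬝ᵥ superpose (fun a x => Qt a x) B).re)
    (hen : ∀ B : μ → ℂ, (star (superpose r B) ⬝ᵥ (A *ᵥ superpose r B)).re ≤ E * nsq B) (w : μ → ℂ) :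
    c ^ 2 / E * nsq w ≤ (star w ⬝ᵥ ((Qt * A⁻¹ * Qtᵀ) *ᵥ w)).re := by
  rw [← sandwich_eq_of_real A Qt hreal]
  exact sandwich_coercive_of_quasiReconstruction A hH hU hpsd _ r hc hE hmass hen w

/-! ## §3 The composite: the coarse layer's `hRe` from a quasi-reconstruction -/

/-- **THE COERCIVITY DATUM OF THE CONSTRAINED LAYER ⟸ A QUASI-RECONSTRUCTION.**  Representatives `e : μ ↪ Y` (`E = embM e`),
the instance statement `Σ_ω Kp_ω = Eᵀ(Q̃A⁻¹Q̃ᵀ − 1)E` (the coarse pieces expand the embedded «Q̃G₂Q̃ᵀ − 1», `G₂ = A⁻¹`),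
`A` Hermitian, invertible, `Re`-psd, `Q̃` real, and a quasi-reconstruction `r` with mass coercivity `c` and energy `E`
⟹ `∀ z, min(c²∕E, 1)·‖z‖² ≤ Re z*(1 + Σ_ω Kp_ω)z` — LITERALLY the `hRe` of the co-owner's
`UnitLatticeOmegaBoxLocal.termSum_box_of_pieceMaj` with `γ := min(c²∕E, 1)`.  So for interface item (I3) the coercivity
datum (G-B9-15's lower bound) IS a bounded-energy quasi-reconstruction for `Q̃` relative to `G₂⁻¹` (NOTE-I3's E-I3).
[cite: Balaban1985BackgroundPropagators, (3.132) p.422] -/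
theorem hRe_coarse_of_quasiReconstruction {Ω' : Type*} [Fintype Ω'] (e : μ → Y) (he : Function.Injective e)
    (A : Matrix X X ℂ) (hH : A.IsHermitian) (hU : IsUnit A) (hpsd : ∀ g : X → ℂ, 0 ≤ (star g ⬝ᵥ (A *ᵥ g)).re)
    (Qt : Matrix μ X ℂ) (hreal : ∀ a x, (starRingEnd ℂ) (Qt a x) = Qt a x) (r : μ → X → ℂ) {c E : ℝ} (hc : 0 < c)
    (hE : 0 < E) (hmass : ∀ B : μ → ℂ, c * nsq B ≤ (star (superpose r B) ⬝ᵥ superpose (fun a x => Qt a x) B).re)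
    (hen : ∀ B : μ → ℂ, (star (superpose r B) ⬝ᵥ (A *ᵥ superpose r B)).re ≤ E * nsq B)
    (Kp : Ω' → Matrix Y Y ℂ) (hKtot : Ktot Kp = (embM e)ᵀ * (Qt * A⁻¹ * Qtᵀ - 1) * embM e) (z : Y → ℂ) :
    min (c ^ 2 / E) 1 * nsq z ≤ (star z ⬝ᵥ ((1 + Ktot Kp) *ᵥ z)).re :=
  reCoercive_one_add_Ktot e he (Qt * A⁻¹ * Qtᵀ)
    (reCoercive_coarse_of_quasiReconstruction A hH hU hpsd Qt hreal r hc hE hmass hen) Kp hKtot z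

/-! ## §4 Real Gram forms, and non-vacuity on the two-site block (where the bound is tight) -/

omit [Fintype μ] [DecidableEq μ] [DecidableEq X] in
/-- A real matrix commutes with entrywise conjugation of vectors: `Q̃·(star z) = star (Q̃ z)`. [folklore] -/
theorem mulVec_star_of_real (Qt : Matrix μ X ℂ) (hreal : ∀ a x, (starRingEnd ℂ) (Qt a x) = Qt a x) (z : X → ℂ) :
    Qt *ᵥ star z = star (Qt *ᵥ z) := by
  ext a
  simp only [Matrix.mulVec, dotProduct, Pi.star_apply, Complex.star_def, map_sum, map_mul, hreal]

omit [DecidableEq μ] in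
/-- **The Gram form of a real averaging**: `z*(1 + Q̃ᵀQ̃)z = ‖z‖² + ‖Q̃z‖²` (as a real number cast to `ℂ`). [folklore] -/
theorem form_one_add_gram (Qt : Matrix μ X ℂ) (hreal : ∀ a x, (starRingEnd ℂ) (Qt a x) = Qt a x) (z : X → ℂ) :
    star z ⬝ᵥ ((1 + Qtᵀ * Qt) *ᵥ z) = ((nsq z + nsq (Qt *ᵥ z) : ℝ) : ℂ) := by
  rw [Matrix.add_mulVec, Matrix.one_mulVec, dotProduct_add, ← Matrix.mulVec_mulVec, Matrix.dotProduct_mulVec,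
    Matrix.vecMul_transpose, mulVec_star_of_real Qt hreal, star_dotProduct_self, star_dotProduct_self, Complex.ofReal_add]

omit [DecidableEq μ] in
/-- … hence `1 + Q̃ᵀQ̃` is `Re`-positive semidefinite. [folklore] -/
theorem re_form_one_add_gram_nonneg (Qt : Matrix μ X ℂ) (hreal : ∀ a x, (starRingEnd ℂ) (Qt a x) = Qt a x)
    (z : X → ℂ) : 0 ≤ (star z ⬝ᵥ ((1 + Qtᵀ * Qt) *ᵥ z)).re := by
  rw [form_one_add_gram Qt hreal, Complex.ofReal_re]
  exact add_nonneg (nsq_nonneg _) (nsq_nonneg _)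

/-- The averaging constraint of the two-site block: `Q̃ = (1 1)`. [folklore] -/
def Qt₂ : Matrix (Fin 1) (Fin 2) ℂ := Matrix.of fun _ _ => 1

/-- The fine form of the two-site block: `A = 1 + Q̃ᵀQ̃ = [[2, 1], [1, 2]]` (`G₂ = A⁻¹ = ⅓[[2,−1],[−1,2]]`). [folklore] -/
def A₂ : Matrix (Fin 2) (Fin 2) ℂ := 1 + Qt₂ᵀ * Qt₂

/-- `Q̃` is real. [folklore] -/
theorem Qt₂_real (a : Fin 1) (x : Fin 2) : (starRingEnd ℂ) (Qt₂ a x) = Qt₂ a x := by simp [Qt₂]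

/-- `A₂` is Hermitian (a real symmetric Gram form). [folklore] -/
theorem A₂_isHermitian : A₂.IsHermitian := by
  have hT : Qt₂ᴴ = Qt₂ᵀ := by
    ext x a
    rw [Matrix.conjTranspose_apply, Matrix.transpose_apply, Complex.star_def, Qt₂_real]
  have hT' : (Qt₂ᵀ)ᴴ = Qt₂ := by
    rw [← hT, Matrix.conjTranspose_conjTranspose]
  rw [A₂, Matrix.IsHermitian, Matrix.conjTranspose_add, Matrix.conjTranspose_one, Matrix.conjTranspose_mul, hT, hT']

/-- `det A₂ = 3`. [folklore] -/
theorem det_A₂ : A₂.det = 3 := by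
  rw [A₂, Matrix.det_fin_two]
  simp [Matrix.add_apply, Matrix.mul_apply, Qt₂]
  norm_num

/-- On the two-site block with `r = q =` the rows of `Q̃`: mass coercivity `c = 2` (`(B·(1,1))*(B·(1,1)) = 2|B|²`), energy
`E = 6` (`‖(B,B)‖² + ‖Q̃(B,B)‖² = 2|B|² + 4|B|²`), hence `Re w*(Q̃A⁻¹Q̃ᵀ)w ≥ (2²∕6)‖w‖² = ⅔‖w‖²` — TIGHT, since
`Q̃A⁻¹Q̃ᵀ = ⅔` (`AnalyticWalkSum216RowConstrainedWitness.coarse_eq`). [folklore] -/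
example (w : Fin 1 → ℂ) : (2 : ℝ) ^ 2 / 6 * nsq w ≤ (star w ⬝ᵥ ((Qt₂ * A₂⁻¹ * Qt₂ᵀ) *ᵥ w)).re := by
  have hU : IsUnit A₂ := by
    rw [Matrix.isUnit_iff_isUnit_det, det_A₂]; exact isUnit_iff_ne_zero.2 (by norm_num)
  have hsup : ∀ B : Fin 1 → ℂ, superpose (fun a x => Qt₂ a x) B = fun _ => B 0 := fun B => by
    ext x
    simp [superpose, Qm, Qt₂, Matrix.mulVec, dotProduct, Matrix.conjTranspose_apply]
  have hnsq1 : ∀ B : Fin 1 → ℂ, nsq B = ‖B 0‖ ^ 2 := fun B => by simp [nsq]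
  have hnsq2 : ∀ c : ℂ, nsq (fun _ : Fin 2 => c) = 2 * ‖c‖ ^ 2 := fun c => by
    simp [nsq]
  have hQv : ∀ c : ℂ, Qt₂ *ᵥ (fun _ : Fin 2 => c) = fun _ => 2 * c := fun c => by
    ext a
    simp [Matrix.mulVec, dotProduct, Qt₂]
  refine reCoercive_coarse_of_quasiReconstruction A₂ A₂_isHermitian hU (re_form_one_add_gram_nonneg Qt₂ Qt₂_real) Qt₂
    Qt₂_real (fun a x => Qt₂ a x) two_pos (by norm_num : (0 : ℝ) < 6) (fun B => ?_) (fun B => ?_) w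
  · -- mass: `(Σ B r)*(Σ B q) = ‖(B,B)‖² = 2|B|²`
    rw [hsup, hnsq1, star_dotProduct_self, Complex.ofReal_re, hnsq2]
  · -- energy: `‖(B,B)‖² + ‖Q̃(B,B)‖² = 2|B|² + ‖2B‖²·1 = 6|B|²`
    rw [hsup, hnsq1, show A₂ = 1 + Qt₂ᵀ * Qt₂ from rfl, form_one_add_gram Qt₂ Qt₂_real, Complex.ofReal_re, hQv, hnsq2,
      hnsq1]
    simp only [norm_mul, Complex.norm_two]
    nlinarith [norm_nonneg (B 0)]

end

end Summit.QuantumFields.BalabanUV.Beta.AnalyticWalkSum216RowConstrainedCoercive
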